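import Summits.QuantumFields.QCD.Theorems.GapBuysCauchyRateRotationRestorationDefs
import Literature.MathematicalPhysics.QuantumFieldTheory.QCDThermalDeterminant
import HarnessLib

/-!
# Stub `stub_evenPermSpinor : EvenPermSpinor` (S1c of line `registered`, reshape r1,
crux stmt-QuantumFields-8840 `RotationRestoration`) — PROVED

Even axis permutations of `ℝ⁴` have `γ₅`-preserving spinor intertwiners: for every `π : Equiv.Perm (Fin 4)`
with `sign π = 1` there are `S, S' : Matrix (Fin 4) (Fin 4) ℂ` with `S γ_μ S' = γ_{π μ}` for all `μ`,
`S S' = 1` (`IsSpinorIntertwiner π S S'`) and `S γ₅ S' = γ₅`.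

Proof (swap induction, Montvay–Münster 1994 App. A): we prove for EVERY permutation `π` the existence of an
intertwiner `(S, S')` with `S γ₅ S' = sign π • γ₅` (`EvenPermSpinor.exists_intertwiner_sign`) and specialise
to `sign π = 1`.
* `π = 1`: `(1, 1)` intertwines the identity (`IsSpinorIntertwiner.refl`), `sign 1 = 1`.
* `π ↦ swap x y * π` (`x ≠ y`): compose (`IsSpinorIntertwiner.trans`; `swap x y * π = π.trans (swap x y)`)
  with the tree's transposition spinors `T = γ₅ (γ_x − γ_y)`, `T' = (γ_x − γ_y) γ₅ / 2`
  (`transpositionSpinor_intertwines`).  Since `γ₅` anticommutes with every `γ_μ` (the tree's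
  `gammaFive_mul_euclideanGamma_mul_gammaFive : γ₅ γ_μ γ₅ = -γ_μ` and `gammaFive_mul_gammaFive : γ₅² = 1` of
  `QCDThermalDeterminant.lean`), `T γ₅ = -γ₅ T` (`transpositionSpinor_mul_gammaFive`), hence
  `T γ₅ T' = -γ₅ (T T') = -γ₅`, and
  `(T S) γ₅ (S' T') = sign π • T γ₅ T' = -(sign π) • γ₅ = sign (swap x y * π) • γ₅`
  (`Equiv.Perm.sign_mul`, `Equiv.Perm.sign_swap`).

References: Montvay–Münster 1994 §4.2 (4.31)–(4.35) and App. A (hypercubic group on Dirac spinors through the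
Clifford algebra; `γ₅` is a pseudoscalar: it picks up the sign of the permutation).
-/

noncomputable section

namespace Summit.QuantumFields.QCD.Cruxes.RotationRestoration.Birth

open Literature.MathematicalPhysics.QuantumLattice Literature.MathematicalPhysics.QuantumFieldTheory
open Matrix

namespace EvenPermSpinor

/-- The transposition spinor `T = γ₅ (γ_μ − γ_ν)` anticommutes with `γ₅`: `T γ₅ = -γ₅ T` (because `γ₅`
anticommutes with every `γ_μ`: `γ₅ γ_μ = γ₅ γ_μ γ₅ γ₅ = -γ_μ γ₅`). [folklore] -/
theorem transpositionSpinor_mul_gammaFive (μ ν : Fin 4) :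
    transpositionSpinor μ ν * gammaFive = -(gammaFive * transpositionSpinor μ ν) := by
  have anti : ∀ k : Fin 4, gammaFive * euclideanGamma k = -(euclideanGamma k * gammaFive) := fun k =>
    calc gammaFive * euclideanGamma k = gammaFive * euclideanGamma k * (gammaFive * gammaFive) := by
          rw [gammaFive_mul_gammaFive, Matrix.mul_one]
      _ = -(euclideanGamma k * gammaFive) := by
          rw [← Matrix.mul_assoc, gammaFive_mul_euclideanGamma_mul_gammaFive, Matrix.neg_mul]
  have h : gammaFive * (euclideanGamma μ - euclideanGamma ν) =
      -((euclideanGamma μ - euclideanGamma ν) * gammaFive) := by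
    rw [Matrix.mul_sub, Matrix.sub_mul, anti, anti, neg_sub_neg, neg_sub]
  calc transpositionSpinor μ ν * gammaFive
      = gammaFive * ((euclideanGamma μ - euclideanGamma ν) * gammaFive) := by
        rw [transpositionSpinor, Matrix.mul_assoc]
    _ = -(gammaFive * transpositionSpinor μ ν) := by
        rw [transpositionSpinor, h, Matrix.mul_neg, neg_neg]

/-- `T γ₅ T' = -γ₅` for the transposition spinor `T = γ₅ (γ_μ − γ_ν)` and any right inverse `T'` of `T`.
[folklore] -/
theorem transpositionSpinor_mul_gammaFive_mul {μ ν : Fin 4} {T' : Matrix (Fin 4) (Fin 4) ℂ}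
    (h : transpositionSpinor μ ν * T' = 1) :
    transpositionSpinor μ ν * gammaFive * T' = -gammaFive := by
  rw [transpositionSpinor_mul_gammaFive, Matrix.neg_mul, Matrix.mul_assoc, h, Matrix.mul_one]

/-- **Every axis permutation has a spinor intertwiner conjugating `γ₅` to `sign π • γ₅`** (swap
induction on `π`; `γ₅` is a pseudoscalar under the hypercubic group).
[cite: MontvayMunster1994, §4.2 and App. A] -/
theorem exists_intertwiner_sign (π : Equiv.Perm (Fin 4)) :
    ∃ Sm Sm' : Matrix (Fin 4) (Fin 4) ℂ, IsSpinorIntertwiner π Sm Sm' ∧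
      Sm * gammaFive * Sm' = ((Equiv.Perm.sign π : ℤ) : ℂ) • gammaFive := by
  induction π using Equiv.Perm.swap_induction_on with
  | one =>
    exact ⟨1, 1, IsSpinorIntertwiner.refl, by
      rw [Equiv.Perm.sign_one, Units.val_one, Int.cast_one, one_smul, Matrix.mul_one, Matrix.one_mul]⟩
  | swap_mul f x y hxy ih =>
    obtain ⟨S, S', hS, hγ⟩ := ih
    have hT := transpositionSpinor_intertwines hxy
    have key : transpositionSpinor x y * S * gammaFive * (S' * transpositionSpinorInv x y) =
        -(((Equiv.Perm.sign f : ℤ) : ℂ) • gammaFive) := by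
      calc transpositionSpinor x y * S * gammaFive * (S' * transpositionSpinorInv x y)
          = transpositionSpinor x y * (S * gammaFive * S') * transpositionSpinorInv x y := by
            simp only [Matrix.mul_assoc]
        _ = ((Equiv.Perm.sign f : ℤ) : ℂ) •
              (transpositionSpinor x y * gammaFive * transpositionSpinorInv x y) := by
            rw [hγ, Matrix.mul_smul, Matrix.smul_mul]
        _ = -(((Equiv.Perm.sign f : ℤ) : ℂ) • gammaFive) := by
            rw [transpositionSpinor_mul_gammaFive_mul hT.2, smul_neg]
    refine ⟨transpositionSpinor x y * S, S' * transpositionSpinorInv x y, ?_, ?_⟩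
    · rw [Equiv.Perm.mul_def]
      exact hS.trans hT
    · rw [key, Equiv.Perm.sign_mul, Equiv.Perm.sign_swap hxy, Units.val_mul, Units.val_neg, Units.val_one,
        Int.cast_mul, Int.cast_neg, Int.cast_one, neg_one_mul, neg_smul]

end EvenPermSpinor

/-- **(S1c) Even axis permutations have `γ₅`-preserving spinor intertwiners**: for every even
`π : Equiv.Perm (Fin 4)` there are `S, S'` with `S γ_μ S' = γ_{π μ}`, `S S' = 1` and `S γ₅ S' = γ₅`
(specialisation of `EvenPermSpinor.exists_intertwiner_sign` to `sign π = 1`).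
[cite: MontvayMunster1994, §4.2 and App. A] -/
theorem stub_evenPermSpinor : EvenPermSpinor := by
  intro π hπ
  obtain ⟨Sm, Sm', h, hγ⟩ := EvenPermSpinor.exists_intertwiner_sign π
  refine ⟨Sm, Sm', h, ?_⟩
  have hπ' : ((Equiv.Perm.sign π : ℤ) : ℂ) = 1 := by
    rw [hπ, Units.val_one, Int.cast_one]
  rw [hγ, hπ', one_smul]

end Summit.QuantumFields.QCD.Cruxes.RotationRestoration.Birth

end
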